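import Summits.ValiantsHypothesis.ValiantsHypothesis.Theorems.BarrierLeverAnchoredDoorHitsLowerPairsPTReduction

/-!
# Support item `AnchoredDoorHitsLowerPairs` (stmt-ValiantsHypothesis-22510), line `anchored-peeling`:
# THE WEIGHTED BOTTOM REDUCTION K1ʷ — anchor weights AND tail weights graded by one variable, with potentials

Helper file (`--supports stmt-ValiantsHypothesis-22510`; cell valiant-natproofs, rung V4; prover seat val-np-p1 gen 26; memo
HOME/val-np-p1/g26/MEMO-conjZ-node-valnp1-g26.md §13b). Closes NO item.

WHAT. `…PTReduction` (K1′, p705454) grades the `y`-tails by `T` and extracts the bottom `T`-coefficient of the determinant under potentials. Here the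
grading is GENERAL: an anchor weight `wθ α ∈ ℕ` on `θ_α` and a uniform tail weight `w ∈ ℕ` on every `ψ_{α d}` (`pwPoint`): the layout entry
`[x^U y^W]` evaluates to `Σ_J Θ^J · xcE Φ U J · ycE Ψ W J · T^{wgrade W J}`, `wgrade W J = Σ_{α ∈ J} wθ α + w · nTails W J` (`aeval_pwPoint_entry`), and
its `T^k`-coefficient is the graded entry `pwEntry k` (`coeff_aeval_pwEntry`). For row potentials `a` and column discounts `c` such that NO entry has a
graded term below its potential (`hvan`, a per-instance combinatorial condition; `pwEntry_eq_zero_of_forall` discharges it from the emptiness of the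
graded index set), K1′'s bottom-coefficient lemma `PT.coeff_det_of_potential` gives

**THEOREM `symbolicDet_ne_zero_of_pwEntry` (K1ʷ).** `det ([c j ≤ a i] · pwEntry (a i − c j) (w j) (u i)) ≠ 0 ⟹ symbolicDet s h r u w ≠ 0`.

USE (memo §13b, the K1″ blueprint): `wθ α = [|B_α| = 1]`, `w` large: the bottom grade selects FIRST the minimum number of tails, THEN the maximum number of
pairs — on tail-free entries this is exactly the profile-2 dominant entry `P2.p2Entry` (`pwEntry_parity_eq_p2Entry`), so the level-0 block of the tight matrix is a
P2 matrix on arbitrary row / column subfamilies, to which the x-elimination certificates `XElim.XCert` apply. Bookkeeping `def`s only: `pwPoint`, `wgrade`, `pwEntry`, `w2`.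

WHAT THIS IS NOT: no pair is certified here; nothing on crux stmt-ValiantsHypothesis-14610 or on `VP` versus `VNP`.
-/

set_option linter.dupNamespace false

namespace Summit.ValiantsHypothesis.ValiantsHypothesis.Theorems.BarrierLever.AnchoredPeeling

open Finset MvPolynomial
open Summit.ValiantsHypothesis.ValiantsHypothesis.Theorems.BarrierLever.BrickCalculus (pexpo pexpo_def)

noncomputable section

namespace PTW

variable {h : ℕ}

/-! ## 1. The weighted point and the graded entries -/

section Point

/-- **The weighted point over `ℂ[T]`:** `θ_α ↦ Θ α · T^{wθ α}`, `φ_{α b} ↦ Φ α b`, `ψ_{α d} ↦ Ψ α d · T^w`. -/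
def pwPoint (wθ : Finset (Fin h) × Finset (Fin h) → ℕ) (w : ℕ) (Θ : Finset (Fin h) × Finset (Fin h) → ℂ)
    (Φ Ψ : Finset (Fin h) × Finset (Fin h) → Fin h → ℂ) : Param h → Polynomial ℂ
  | Sum.inl α => Polynomial.C (Θ α) * Polynomial.X ^ wθ α
  | Sum.inr (Sum.inl q) => Polynomial.C (Φ q.1 q.2)
  | Sum.inr (Sum.inr q) => Polynomial.C (Ψ q.1 q.2) * Polynomial.X ^ w

/-- The grade of an anchor set on the column `W`: `Σ_{α ∈ J} wθ α + w · nTails W J`. -/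
def wgrade (wθ : Finset (Fin h) × Finset (Fin h) → ℕ) (w : ℕ) (W : Finset (Fin h)) (J : Finset (Finset (Fin h) × Finset (Fin h))) : ℕ :=
  ∑ α ∈ J, wθ α + w * PT.nTails W J

open Classical in
/-- **The graded entry at grade `k`:** `Σ_{J ⊆ anchors s h, wgrade W J = k} Θ^J · xcE Φ U J · ycE Ψ W J`. -/
def pwEntry (wθ : Finset (Fin h) × Finset (Fin h) → ℕ) (w : ℕ) (s k : ℕ) (Θ : Finset (Fin h) × Finset (Fin h) → ℂ)
    (Φ Ψ : Finset (Fin h) × Finset (Fin h) → Fin h → ℂ) (W U : Finset (Fin h)) : ℂ :=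
  ∑ J ∈ ((anchors s h).powerset).filter (fun J : Finset (Finset (Fin h) × Finset (Fin h)) => wgrade wθ w W J = k),
    (∏ α ∈ J, Θ α) * P2.xcE Φ U J * PT.ycE Ψ W J

variable {wθ : Finset (Fin h) × Finset (Fin h) → ℕ} {w : ℕ} {Θ : Finset (Fin h) × Finset (Fin h) → ℂ}
  {Φ Ψ : Finset (Fin h) × Finset (Fin h) → Fin h → ℂ}

/-- `aeval` at the weighted point on a `θ`-variable. -/
theorem aeval_pwPoint_theta (α : Finset (Fin h) × Finset (Fin h)) :
    aeval (pwPoint wθ w Θ Φ Ψ) (X (Sum.inl α) : MvPolynomial (Param h) ℂ) = Polynomial.C (Θ α) * Polynomial.X ^ wθ α := by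
  rw [aeval_X]; rfl

/-- `aeval` at the weighted point on a `φ`-variable. -/
theorem aeval_pwPoint_phi (α : Finset (Fin h) × Finset (Fin h)) (b : Fin h) :
    aeval (pwPoint wθ w Θ Φ Ψ) (X (Sum.inr (Sum.inl (α, b))) : MvPolynomial (Param h) ℂ) = Polynomial.C (Φ α b) := by
  rw [aeval_X]; rfl

/-- `aeval` at the weighted point on a `ψ`-variable. -/
theorem aeval_pwPoint_psi (α : Finset (Fin h) × Finset (Fin h)) (d : Fin h) :
    aeval (pwPoint wθ w Θ Φ Ψ) (X (Sum.inr (Sum.inr (α, d))) : MvPolynomial (Param h) ℂ) = Polynomial.C (Ψ α d) * Polynomial.X ^ w := by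
  rw [aeval_X]; rfl

/-- The `θ`-monomial of `J` evaluates to `Θ^J · T^{Σ wθ}`. -/
theorem aeval_thetaMon (J : Finset (Finset (Fin h) × Finset (Fin h))) :
    aeval (pwPoint wθ w Θ Φ Ψ) (AnchorSets.thetaMon J) = Polynomial.C (∏ α ∈ J, Θ α) * Polynomial.X ^ (∑ α ∈ J, wθ α) := by
  rw [AnchorSets.thetaMon, map_prod, Finset.prod_congr rfl (fun α _ => aeval_pwPoint_theta α), Finset.prod_mul_distrib, map_prod,
    Finset.prod_pow_eq_pow_sum]

/-- The `x`-coefficient evaluates to the constant `P2.xcE`. -/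
theorem aeval_xcoeff (U : Finset (Fin h)) (J : Finset (Finset (Fin h) × Finset (Fin h))) :
    aeval (pwPoint wθ w Θ Φ Ψ) (AnchorSets.xcoeff U J) = Polynomial.C (P2.xcE Φ U J) := by
  classical
  rw [AnchorSets.xcoeff_eq, P2.xcE]
  by_cases hc : (J : Set (Finset (Fin h) × Finset (Fin h))).PairwiseDisjoint Prod.fst ∧ AnchorSets.xFoot J ⊆ U
  · rw [if_pos hc, if_pos hc, map_prod, map_prod]
    refine Finset.prod_congr rfl (fun b _ => ?_)
    rw [map_sum, map_sum]
    exact Finset.sum_congr rfl (fun α _ => aeval_pwPoint_phi α b)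
  · rw [if_neg hc, if_neg hc, map_zero, map_zero]

/-- **The `y`-coefficient evaluates to `ycE · T^{w · nTails}`.** -/
theorem aeval_ycoeff (W : Finset (Fin h)) (J : Finset (Finset (Fin h) × Finset (Fin h))) :
    aeval (pwPoint wθ w Θ Φ Ψ) (AnchorSets.ycoeff W J) = Polynomial.C (PT.ycE Ψ W J) * Polynomial.X ^ (w * PT.nTails W J) := by
  classical
  rw [AnchorSets.ycoeff_eq, PT.ycE]
  by_cases hc : (J : Set (Finset (Fin h) × Finset (Fin h))).PairwiseDisjoint Prod.snd ∧ AnchorSets.yFoot J ⊆ W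
  · rw [if_pos hc, if_pos hc, map_prod]
    have hz : ∀ d ∈ W \ AnchorSets.yFoot J,
        aeval (pwPoint wθ w Θ Φ Ψ) (∑ α ∈ J, (X (Sum.inr (Sum.inr (α, d))) : MvPolynomial (Param h) ℂ)) =
          Polynomial.C (∑ α ∈ J, Ψ α d) * Polynomial.X ^ w := by
      intro d _
      rw [map_sum, Finset.sum_congr rfl (fun α _ => aeval_pwPoint_psi α d), ← Finset.sum_mul, ← map_sum]
    rw [Finset.prod_congr rfl hz, Finset.prod_mul_distrib, ← map_prod, Finset.prod_const, PT.nTails, ← pow_mul]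
  · rw [if_neg hc, if_neg hc, map_zero, map_zero, zero_mul]

/-- **The evaluated layout entry:** `Σ_J Θ^J · xcE U J · ycE W J · T^{wgrade W J}`. -/
theorem aeval_pwPoint_entry (s : ℕ) (U W : Finset (Fin h)) :
    aeval (pwPoint wθ w Θ Φ Ψ) (coeff (pexpo U W) (symbolicWitness s h)) =
      ∑ J ∈ (anchors s h).powerset, Polynomial.C ((∏ α ∈ J, Θ α) * P2.xcE Φ U J * PT.ycE Ψ W J) * Polynomial.X ^ wgrade wθ w W J := by
  rw [AnchorSets.coeff_symbolicWitness_eq_sum, map_sum]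
  refine Finset.sum_congr rfl (fun J _ => ?_)
  rw [map_mul, map_mul, aeval_thetaMon, aeval_xcoeff, aeval_ycoeff, map_mul, map_mul, wgrade, pow_add]
  ring

/-- **Coefficient extraction:** the `T^k`-coefficient of the evaluated entry is the graded entry `pwEntry k`. -/
theorem coeff_aeval_pwEntry (s k : ℕ) (U W : Finset (Fin h)) :
    (aeval (pwPoint wθ w Θ Φ Ψ) (coeff (pexpo U W) (symbolicWitness s h))).coeff k = pwEntry wθ w s k Θ Φ Ψ W U := by
  classical
  rw [aeval_pwPoint_entry, Polynomial.finsetSum_coeff, pwEntry, Finset.sum_filter]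
  refine Finset.sum_congr rfl (fun J _ => ?_)
  rw [Polynomial.coeff_C_mul_X_pow]
  by_cases hq : wgrade wθ w W J = k
  · rw [if_pos hq.symm, if_pos hq]
  · rw [if_neg (fun h' => hq h'.symm), if_neg hq]

/-- **Combinatorial vanishing:** if no anchor set `J ⊆ anchors s h` with `x`-parts pairwise disjoint inside `U` and `y`-parts pairwise disjoint inside
`W` has grade `k`, then `pwEntry k W U = 0`. -/
theorem pwEntry_eq_zero_of_forall (s k : ℕ) (W U : Finset (Fin h))
    (hk : ∀ J ⊆ anchors s h, (J : Set (Finset (Fin h) × Finset (Fin h))).PairwiseDisjoint Prod.fst → AnchorSets.xFoot J ⊆ U →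
      (J : Set (Finset (Fin h) × Finset (Fin h))).PairwiseDisjoint Prod.snd → AnchorSets.yFoot J ⊆ W → wgrade wθ w W J ≠ k) :
    pwEntry wθ w s k Θ Φ Ψ W U = 0 := by
  classical
  rw [pwEntry]
  refine Finset.sum_eq_zero (fun J hJ => ?_)
  obtain ⟨hJp, hJk⟩ := Finset.mem_filter.mp hJ
  have hJs : J ⊆ anchors s h := Finset.mem_powerset.mp hJp
  by_cases hx : (J : Set (Finset (Fin h) × Finset (Fin h))).PairwiseDisjoint Prod.fst ∧ AnchorSets.xFoot J ⊆ U
  · by_cases hy : (J : Set (Finset (Fin h) × Finset (Fin h))).PairwiseDisjoint Prod.snd ∧ AnchorSets.yFoot J ⊆ W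
    · exact absurd hJk (hk J hJs hx.1 hx.2 hy.1 hy.2)
    · rw [PT.ycE, if_neg hy, mul_zero]
  · rw [P2.xcE, if_neg hx, mul_zero, zero_mul]

/-- **The K1″ weighting:** singleton `y`-blocks weigh `1`, pair blocks `0` (so that, with tail weight `w ≥ 2`, the bottom grade selects first «no
tails», then «maximum number of pairs»). -/
def w2 : Finset (Fin h) × Finset (Fin h) → ℕ := fun α => if α.2.card = 2 then 0 else 1

/-- The `w2`-weight sum of an anchor set counts its non-pair anchors. -/
theorem sum_w2_eq (J : Finset (Finset (Fin h) × Finset (Fin h))) :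
    ∑ α ∈ J, w2 α = (J.filter (fun α : Finset (Fin h) × Finset (Fin h) => ¬ α.2.card = 2)).card := by
  classical
  rw [Finset.card_filter]
  refine Finset.sum_congr rfl (fun α _ => ?_)
  rw [w2]
  by_cases h2 : α.2.card = 2
  · rw [if_pos h2, if_neg (not_not.mpr h2)]
  · rw [if_neg h2, if_pos h2]

/-- For a `y`-partition of `W` by profile-2 anchors: `|W| = 2 · nPairs + #non-pairs`. -/
theorem card_eq_of_yPart {W : Finset (Fin h)} {J : Finset (Finset (Fin h) × Finset (Fin h))} (hJ : J ⊆ anchors 2 h)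
    (hd : (J : Set (Finset (Fin h) × Finset (Fin h))).PairwiseDisjoint Prod.snd) (hfoot : AnchorSets.yFoot J = W) :
    W.card = 2 * P2.nPairs J + ∑ α ∈ J, w2 α := by
  classical
  rw [← hfoot, P2.card_yFoot_eq_sum hd, P2.nPairs, sum_w2_eq, Finset.card_filter, Finset.card_filter, Finset.mul_sum, ← Finset.sum_add_distrib]
  refine Finset.sum_congr rfl (fun α hα => ?_)
  have hmem := hJ hα
  simp only [anchors, Finset.mem_filter, Finset.mem_univ, true_and] at hmem
  by_cases h2 : α.2.card = 2
  · rw [if_pos h2, if_neg (not_not.mpr h2), h2]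
    norm_num
  · rw [if_neg h2, if_pos h2]
    omega

/-- **LEVEL ZERO IS THE PROFILE-2 DOMINANT ENTRY.** With the K1″ weighting and tail weight `w ≥ 2`, the graded entry at the parity grade `|W| mod 2`
is exactly `P2.p2Entry Θ Φ W U` (the anchor sets whose `y`-parts partition `W` with the maximum number of pairs; no tails). Hence on the tight entries
of tail count `0` the weighted dominant matrix is a P2 matrix — the object certified by `XElim.XCert`. -/
theorem pwEntry_parity_eq_p2Entry (hw : 2 ≤ w) (W U : Finset (Fin h)) :
    pwEntry w2 w 2 (W.card % 2) Θ Φ Ψ W U = P2.p2Entry Θ Φ W U := by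
  classical
  rw [pwEntry, P2.p2Entry, Finset.sum_filter, Finset.sum_filter]
  refine Finset.sum_congr rfl (fun J hJ => ?_)
  have hJs : J ⊆ anchors 2 h := Finset.mem_powerset.mp hJ
  by_cases hy : (J : Set (Finset (Fin h) × Finset (Fin h))).PairwiseDisjoint Prod.snd ∧ AnchorSets.yFoot J ⊆ W
  · by_cases hfoot : AnchorSets.yFoot J = W
    · -- no tails: `ycE = 1`, grade = number of non-pairs
      have hyc : PT.ycE Ψ W J = 1 := by
        rw [PT.ycE, if_pos hy, hfoot, Finset.sdiff_self, Finset.prod_empty]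
      have htails : PT.nTails W J = 0 := by rw [PT.nTails, hfoot, Finset.sdiff_self, Finset.card_empty]
      have hgrade : wgrade w2 w W J = ∑ α ∈ J, w2 α := by rw [wgrade, htails, mul_zero, add_zero]
      have hcard := card_eq_of_yPart hJs hy.1 hfoot
      have hYP : P2.YPart W J := ⟨hy.1, hfoot⟩
      by_cases hk : wgrade w2 w W J = W.card % 2
      · have hp : P2.nPairs J = W.card / 2 := by omega
        rw [if_pos hk, if_pos ⟨hYP, hp⟩, hyc, mul_one]
      · have hp : ¬ P2.nPairs J = W.card / 2 := by
          intro hp; apply hk; omega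
        rw [if_neg hk, if_neg (fun hc => hp hc.2)]
    · -- at least one tail: grade ≥ w ≥ 2 > parity
      have htails : 1 ≤ PT.nTails W J := by
        rw [PT.nTails]
        refine Finset.card_pos.mpr ?_
        by_contra hem
        rw [Finset.not_nonempty_iff_eq_empty, Finset.sdiff_eq_empty_iff_subset] at hem
        exact hfoot (Finset.Subset.antisymm hy.2 hem)
      have hk : ¬ wgrade w2 w W J = W.card % 2 := by
        intro hk
        have h1 : W.card % 2 < 2 := Nat.mod_lt _ (by norm_num)
        have h2 : w * 1 ≤ w * PT.nTails W J := Nat.mul_le_mul_left w htails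
        rw [wgrade] at hk
        omega
      rw [if_neg hk, if_neg (fun hc => hfoot hc.1.2)]
  · have hyc : PT.ycE Ψ W J = 0 := by rw [PT.ycE, if_neg hy]
    rw [hyc, mul_zero]
    by_cases hk : wgrade w2 w W J = W.card % 2
    · rw [if_pos hk]
      by_cases hc : P2.YPart W J ∧ P2.nPairs J = W.card / 2
      · exact absurd ⟨hc.1.1, hc.1.2.le⟩ hy
      · rw [if_neg hc]
    · rw [if_neg hk]
      by_cases hc : P2.YPart W J ∧ P2.nPairs J = W.card / 2
      · exact absurd ⟨hc.1.1, hc.1.2.le⟩ hy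
      · rw [if_neg hc]

end Point

/-! ## 2. THE WEIGHTED BOTTOM REDUCTION K1ʷ -/

section Det

variable (wθ : Finset (Fin h) × Finset (Fin h) → ℕ) (w : ℕ) (Θ : Finset (Fin h) × Finset (Fin h) → ℂ)
  (Φ Ψ : Finset (Fin h) × Finset (Fin h) → Fin h → ℂ)

/-- **THE WEIGHTED BOTTOM REDUCTION, at every profile `s`, for every weighting.** Row potentials `a i`, column discounts `c j`; ADMISSIBILITY is the
hypothesis `hvan`: no entry has a graded term strictly below its potential `a i − c j` (dischargeable by `pwEntry_eq_zero_of_forall`). If the graded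
dominant matrix `N i j = [c j ≤ a i] · pwEntry (a i − c j) Θ Φ Ψ (w j) (u i)` is nonsingular, then `symbolicDet s h r u w ≠ 0`. -/
theorem symbolicDet_ne_zero_of_pwEntry {s r : ℕ} (u v : Fin r → Finset (Fin h)) (a c : Fin r → ℕ)
    (hvan : ∀ i j, ∀ k, k + c j < a i → pwEntry wθ w s k Θ Φ Ψ (v j) (u i) = 0)
    (hdet : (Matrix.of fun i j : Fin r => if c j ≤ a i then pwEntry wθ w s (a i - c j) Θ Φ Ψ (v j) (u i) else 0).det ≠ 0) :
    symbolicDet s h r u v ≠ 0 := by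
  classical
  intro h0
  set M : Matrix (Fin r) (Fin r) (Polynomial ℂ) :=
    Matrix.of fun i j : Fin r => aeval (pwPoint wθ w Θ Φ Ψ) (coeff (pexpo (u i) (v j)) (symbolicWitness s h)) with hM
  have hmap : aeval (pwPoint wθ w Θ Φ Ψ) (symbolicDet s h r u v) = M.det := by
    rw [symbolicDet, AlgHom.map_det]
    congr 1
  have hMdet : M.det = 0 := by rw [← hmap, h0, map_zero]
  set M' : Matrix (Fin r) (Fin r) (Polynomial ℂ) := Matrix.of fun i j : Fin r => Polynomial.X ^ c j * M i j with hM'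
  have hM'eq : M' = M * Matrix.diagonal (fun j => Polynomial.X ^ c j) := by
    ext i j
    rw [hM', Matrix.of_apply, Matrix.mul_diagonal, mul_comm]
  have hM'det : M'.det = 0 := by rw [hM'eq, Matrix.det_mul, hMdet, zero_mul]
  have hvan' : ∀ i j, ∀ k < a i + (fun _ : Fin r => 0) j, (M' i j).coeff k = 0 := by
    intro i j k hk
    simp only [add_zero] at hk
    rw [hM', Matrix.of_apply, Polynomial.coeff_X_pow_mul']
    by_cases hkc : c j ≤ k
    · rw [if_pos hkc, hM, Matrix.of_apply, coeff_aeval_pwEntry]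
      exact hvan i j (k - c j) (by omega)
    · rw [if_neg hkc]
  have hbot := PT.coeff_det_of_potential M' a (fun _ => 0) hvan'
  rw [hM'det, Polynomial.coeff_zero] at hbot
  have hmat : (Matrix.of fun i j : Fin r => (M' i j).coeff (a i + (fun _ : Fin r => 0) j)) =
      Matrix.of fun i j : Fin r => if c j ≤ a i then pwEntry wθ w s (a i - c j) Θ Φ Ψ (v j) (u i) else 0 := by
    ext i j
    rw [Matrix.of_apply, Matrix.of_apply, hM', Matrix.of_apply, add_zero, Polynomial.coeff_X_pow_mul']
    by_cases hca : c j ≤ a i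
    · rw [if_pos hca, if_pos hca, hM, Matrix.of_apply, coeff_aeval_pwEntry]
    · rw [if_neg hca, if_neg hca]
  exact hdet (by rw [← hmat, ← hbot])

end Det

end PTW

end

end Summit.ValiantsHypothesis.ValiantsHypothesis.Theorems.BarrierLever.AnchoredPeeling
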